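import Summits.MatrixMultiplication.OmegaCensus.SmallFormats.MatMul225GF3FrameCapCertificate
import Literature.Computability.AlgebraicComplexity.MatMul22mRankFiniteField
import Mathlib.RingTheory.Localization.Away.Basic
import Mathlib.NumberTheory.Padics.RingHoms
import HarnessLib

/-!
# ω-census family (a): `R_K(⟨2,2,5⟩) = 18` for every commutative ring `K` that maps to `𝔽₃` (or `𝔽₂`) — `ℤ`, `ℤ/9`, `ℤ[1/2]`, `ℤ[1/3]`, `ℤ₃`

Cell `pub-omega` (unit `pub-omega-tensor`, gen 37), topic `Summits/MatrixMultiplication/OmegaCensus` (sub-folder `SmallFormats`). Framing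
(verbatim): lottery ticket; floor = certified bounds/negative ranges. HONEST FRAMING: immediate corollaries of this generation's kernel theorem
`Enum723.tensorRank_225_gf3 : R_𝔽₃(⟨2,2,5⟩) = 18` (p708804) by base change (Bläser 1999 §5 (10), tree `tensorRank_matMulTensor_map_le`: a
decomposition over `K` maps along any ring homomorphism `K → 𝔽₃` to one over `𝔽₃` of the same length) and Hopcroft–Kerr's 18-product algorithm,
which is valid over every commutative ring (`hopcroftKerr1971_tensorRank_matMulTensor_22n_le`).

WHAT IT SAYS FOR SEARCHES (the census's family (a) grammar): a rational length-17 algorithm for `⟨2,2,5⟩` — if one exists at all — must have a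
coefficient whose denominator is divisible by `3` (this file: the algorithm cannot live in any ring mapping to `𝔽₃`, e.g. `ℤ[1/2]`) and one
whose denominator is divisible by `2` (Hopcroft–Kerr 1971 / Alekseev–Nazarov 2019 over `𝔽₂`, tree `tensorRank_matMulTensor_22n_card_two`,
base-changed the same way: `tensorRank_225_eq_eighteen_of_ringHom_zmod2`, e.g. `ℤ[1/3]`). So flip-graph / AlphaTensor-style searches over `ℤ`,
`ℤ[1/2]`, `ℤ[1/3]`, `ℤ/9`, `ℤ₂`, `ℤ₃` cannot find a 17-product scheme for `⟨2,2,5⟩`. Nothing here is a bound on `ω`; the rank over `ℚ`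
(17 or 18; Alekseev 2014) stays open.
-/

namespace Summit.MatrixMultiplication.OmegaCensus.SmallFormats

open Literature.Computability.AlgebraicComplexity

/-- **`R_K(⟨2,2,5⟩) = 18` for every commutative ring `K` with a ring homomorphism to `𝔽₃`** (base change of `R_𝔽₃(⟨2,2,5⟩) = 18`
down the homomorphism; Hopcroft–Kerr's integral 18-product scheme up). -/
theorem tensorRank_225_eq_eighteen_of_ringHom_zmod3 {K : Type*} [CommRing K] (f : K →+* ZMod 3) :
    tensorRank (matMulTensor K 2 2 5) = 18 := by
  have h1 := tensorRank_matMulTensor_map_le f 2 2 5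
  have h2 := hopcroftKerr1971_tensorRank_matMulTensor_22n_le (K := K) 5
  have h3 := Enum723.tensorRank_225_gf3
  norm_num at h2
  omega

/-- **No length-17 algorithm over such a ring**: `18 ≤ R_K(⟨2,2,5⟩)` whenever `K → 𝔽₃` exists (also for commutative semirings). -/
theorem eighteen_le_tensorRank_225_of_ringHom_zmod3 {K : Type*} [CommSemiring K] (f : K →+* ZMod 3) :
    18 ≤ tensorRank (matMulTensor K 2 2 5) := by
  have h1 := tensorRank_matMulTensor_map_le f 2 2 5
  have h3 := Enum723.tensorRank_225_gf3
  omega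

/-- **`R_K(⟨2,2,5⟩) = 18` for every commutative ring `K` with a ring homomorphism to `𝔽₂`** (Hopcroft–Kerr 1971 / Alekseev–Nazarov 2019
over `𝔽₂`, base-changed). -/
theorem tensorRank_225_eq_eighteen_of_ringHom_zmod2 {K : Type*} [CommRing K] (f : K →+* ZMod 2) :
    tensorRank (matMulTensor K 2 2 5) = 18 := by
  haveI : Fact (Nat.Prime 2) := ⟨Nat.prime_two⟩
  have h1 := tensorRank_matMulTensor_map_le f 2 2 5
  have h2 := hopcroftKerr1971_tensorRank_matMulTensor_22n_le (K := K) 5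
  have h3 := tensorRank_matMulTensor_22n_card_two (ZMod 2) (ZMod.card 2) 5
  norm_num at h2 h3
  omega

/-- **Over the integers**: `R_ℤ(⟨2,2,5⟩) = 18` (already a consequence of Hopcroft–Kerr 1971 over `𝔽₂`; here from `𝔽₃`). -/
theorem tensorRank_225_int : tensorRank (matMulTensor ℤ 2 2 5) = 18 :=
  tensorRank_225_eq_eighteen_of_ringHom_zmod3 (Int.castRingHom (ZMod 3))

/-- **Over `ℤ/9`** (a ring of characteristic `9`, where neither the `𝔽₂` nor a field argument applies directly): `R(⟨2,2,5⟩) = 18`. -/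
theorem tensorRank_225_zmod9 : tensorRank (matMulTensor (ZMod 9) 2 2 5) = 18 :=
  tensorRank_225_eq_eighteen_of_ringHom_zmod3 (ZMod.castHom (show 3 ∣ 9 by norm_num) (ZMod 3))

/-- **Over the dyadic integers `ℤ[1/2]`** (the coefficient ring of the AlphaTensor / flip-graph record schemes; reduction mod `2` is NOT available
there): `R_{ℤ[1/2]}(⟨2,2,5⟩) = 18` — a rational length-17 algorithm for `⟨2,2,5⟩` needs a denominator divisible by `3`. -/
theorem tensorRank_225_dyadic : tensorRank (matMulTensor (Localization.Away (2 : ℤ)) 2 2 5) = 18 := by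
  have h2 : IsUnit ((Int.castRingHom (ZMod 3)) 2) := by decide
  exact tensorRank_225_eq_eighteen_of_ringHom_zmod3
    (IsLocalization.Away.lift (S := Localization.Away (2 : ℤ)) (2 : ℤ) h2)

/-- **Over `ℤ[1/3]`** (reduction mod `3` unavailable; mod `2` available): `R_{ℤ[1/3]}(⟨2,2,5⟩) = 18`. -/
theorem tensorRank_225_triadic : tensorRank (matMulTensor (Localization.Away (3 : ℤ)) 2 2 5) = 18 := by
  have h3 : IsUnit ((Int.castRingHom (ZMod 2)) 3) := by decide
  exact tensorRank_225_eq_eighteen_of_ringHom_zmod2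
    (IsLocalization.Away.lift (S := Localization.Away (3 : ℤ)) (3 : ℤ) h3)

/-- **Over the `3`-adic integers**: `R_{ℤ₃}(⟨2,2,5⟩) = 18`. -/
theorem tensorRank_225_padicInt3 : tensorRank (matMulTensor ℤ_[3] 2 2 5) = 18 :=
  tensorRank_225_eq_eighteen_of_ringHom_zmod3 (PadicInt.toZMod (p := 3))

end Summit.MatrixMultiplication.OmegaCensus.SmallFormats
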